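import Summits.Ventures.LatticeQCDFlow.Scaling.DominatedStarRegimeFreeCost
import Summits.Ventures.LatticeQCDFlow.Scaling.AllocationCostLaw

/-!
HONEST FRAMING: exact (Metropolis-corrected) sampling algorithms for lattice gauge theory; figures
of merit are autocorrelation/cost numbers at stated couplings and volumes; no continuum-physics
claim.

# EntryStarGapLaw — THE REGIME-FREE GAP OF THE MAP-ASSISTED HOT-REFRESHED HUB IS A MINIMUM OF TWO BUDGETS, FROM BOTH SIDES:
# `p·min{ct/(3m), (1−t)w_0/(7K)} ≤ Gap ≤ min{t/(2Kv), (1−t)w_0·μ_0(A)μ_0(Aᶜ)/((K+1)v)}` FOR SECTOR-PRESERVING ENTRY MAPS OVER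
# SECTOR-IDLE COLD REPLICAS (`μ_k(A)μ_k(Aᶜ) ≥ v`); AT UNIFORM LISTING BOTH SIDES ARE `Θ(min{t, (1−t)w_0}/K)` UP TO `p`, `v`; AND ONE
# RELAXATION TIME COSTS BETWEEN `2Kv·κ_s + (K+1)v·κ_u/(μ_0(A)μ_0(Aᶜ))` AND `7K(κ_s + κ_u)/p` AT HALF SWAPS (lean-2 GEN-28, ours)

Venture-side (OURS).  Cell `lqcd-flow` (pub-lqcd), unit `pub-lqcd-lean-2-g28`, 2026-08-28.  Chapter N, file 7: the law.  The floor
is `Scaling/DominatedStarRegimeFreeGap` (N2); the two ceilings are chapter K's universal ones (`Scaling/AllocationCostLaw`, K7: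
`Gap ≤ t/(2Kv)` from the diluted handover of one sector-idle cold replica, `Gap ≤ (1−t)w_0·Q_0(A,Aᶜ)/((K+1)v)` from the sector
count that only the hot update mints), valid for ANY edge list with sector-preserving entry maps — in particular for the hub list
`r ↦ (0, κ_r+1)` of chapter M.  For the exact hot sampler `Q_0(A,Aᶜ) = μ_0(A)μ_0(Aᶜ) ≤ ¼`.

## What is proved

* `exactSampler_edgeMeasure` (`Q_0(A,Aᶜ) = μ_0(A)·μ_0(Aᶜ)` for `M_0(u,·) = μ_0`).
* **`entryStar_spectralGap_two_sided`** — exact hot sampler, one-sided transported domination `p`, SECTOR-PRESERVING entry maps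
  `φ_r(A) = A`, cold replicas sector-idle (`w_k·Q_k(A,Aᶜ) = 0`, `k ≠ 0`) and `μ_k`-reversible, `μ_k(A)μ_k(Aᶜ) ≥ v > 0` at every
  level, multiplicities `≥ c ≥ 1`, `0 < t < 1`, `w_0 > 0`:
  **`p·min{ct/(3m), (1−t)w_0/(7K)} ≤ Gap ≤ min{t/(2Kv), (1−t)w_0·μ_0(A)μ_0(Aᶜ)/((K+1)v)}`**.
* **`uniformEntryStar_spectralGap_two_sided`** — uniform listing `m = cK`:
  `p·min{t/(3K), (1−t)w_0/(7K)} ≤ Gap ≤ min{t/(2Kv), (1−t)w_0/(4(K+1)v)}`.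
* **`halfStar_relaxationCost_two_sided`** — `t = 1/2`, `w_0 = 1`, `m = cK`, swap test `κ_s`, hot draw `κ_u` (cold updates free):
  `2Kv·κ_s + (K+1)v·κ_u/(μ_0(A)μ_0(Aᶜ)) ≤ (κ_s + κ_u)/2 · t_rel`-type bill `≤ 7K(κ_s + κ_u)/p` — stated as the pair of inequalities
  `K7 floor ≤ (mean step cost)/Gap` and `(mean step cost)·t_rel ≤ 7K(κ_s + κ_u)/p`.

Reading (no numerics implied): the swap budget `t/K` and the refresh budget `(1−t)w_0/K` are each NECESSARY (a sector-idle cold replica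
relaxes no faster than it is offered the hot configuration; the sector census relaxes no faster than the hot level mints new labels) and
jointly SUFFICIENT up to the transport quality `p` and the sector balance `v` — with no condition tying `t` to `p`.  NOT CLAIMED: maps
that move mass across the sector `A` (then only the floor); cold replicas that cross `A` by themselves; the `log K` of the mixing time
(item 1); anything measured.  Literature grade (cell rule): OWN COMPOSITION (N2 + K7); nothing cited as a fact; no new bib keys.
-/

noncomputable section

open Finset Function
open Literature.Probability.MarkovChains

namespace Summit.Ventures.LatticeQCDFlow.Scaling

variable {S : Type*} [Fintype S] [DecidableEq S] {K m : ℕ} {μ : Fin (K + 1) → S → ℝ} {M : Fin (K + 1) → S → S → ℝ}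
  {w : Fin (K + 1) → ℝ} {t p : ℝ}

omit [DecidableEq S] in
/-- The exact hot sampler's edge measure across a sector: `Q_0(A,Aᶜ) = μ_0(A)·μ_0(Aᶜ)`. [ours] -/
theorem exactSampler_edgeMeasure [DecidableEq S] (hM0 : ∀ u v, M 0 u v = μ 0 v) (A : Finset S) :
    edgeMeasure (μ 0) (M 0) A Aᶜ = (∑ u ∈ A, μ 0 u) * ∑ u ∈ Aᶜ, μ 0 u := by
  unfold edgeMeasure
  rw [sum_mul]
  refine sum_congr rfl fun x _ => ?_
  rw [mul_sum]
  exact sum_congr rfl fun y _ => by rw [hM0]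

section Law
variable (κ : Fin m → Fin K) (φ : Fin m → Equiv.Perm S)

/-- **THE TWO-SIDED REGIME-FREE GAP LAW OF THE MAP-ASSISTED HOT-REFRESHED HUB.**  Exact hot sampler, one-sided transported
domination `p·μ_{κ_r+1}(φ_r u) ≤ μ_0(u)` (`0 < p ≤ 1`), entry maps preserving a sector `A` (`φ_r u ∈ A ↔ u ∈ A`), cold kernels
`μ_k`-reversible and SECTOR-IDLE (`w_k·Q_k(A,Aᶜ) = 0` for `k ≠ 0`), `μ_k(A)μ_k(Aᶜ) ≥ v > 0` for all `k`, every cold level listed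
`≥ c ≥ 1` times, `0 < t < 1`, `w ≥ 0`, `Σw = 1`, `w_0 > 0`, `K ≥ 1`, `|S| ≥ 2`:
**`p·min{ct/(3m), (1−t)w_0/(7K)} ≤ Gap ≤ min{t/(2Kv), (1−t)w_0·μ_0(A)μ_0(Aᶜ)/((K+1)v)}`**. [ours] -/
theorem entryStar_spectralGap_two_sided [Nontrivial S] (hK : 1 ≤ K) (hm : 1 ≤ m) (ht0 : 0 < t) (ht1 : t < 1)
    (hw0 : ∀ k, 0 ≤ w k) (hw00 : 0 < w 0) (hw1 : ∑ k, w k = 1) (hμ : ∀ k x, 0 < μ k x)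
    (hμ1 : ∀ k, ∑ u, μ k u = 1) (hM : ∀ k, IsRowStochastic (M k)) (hMrev : ∀ k, DetailedBalance (μ k) (M k))
    (hM0 : ∀ u v, M 0 u v = μ 0 v) (hp0 : 0 < p) (hp1 : p ≤ 1) (hdom : ∀ r u, p * μ (κ r).succ (φ r u) ≤ μ 0 u)
    {c : ℕ} (hc1 : 1 ≤ c) (hc : ∀ p' : Fin K, c ≤ (univ.filter (fun r : Fin m => κ r = p')).card)
    {A : Finset S} (hφA : ∀ r u, φ r u ∈ A ↔ u ∈ A) {v : ℝ} (hvpos : 0 < v)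
    (hv : ∀ k : Fin (K + 1), v ≤ (∑ u ∈ A, μ k u) * ∑ u ∈ Aᶜ, μ k u)
    (hidle : ∀ k : Fin (K + 1), k ≠ 0 → w k * edgeMeasure (μ k) (M k) A Aᶜ = 0) :
    p * min (c * t / (3 * m)) ((1 - t) * w 0 / (7 * K))
        ≤ spectralGap (tensorFun μ) (fun y z : Fin (K + 1) → S =>
            t * ptGraphSwap μ (fun r : Fin m => (((0 : Fin (K + 1)), (κ r).succ) : Fin (K + 1) × Fin (K + 1))) φ y z
              + (1 - t) * prodKernel w M y z)
      ∧ spectralGap (tensorFun μ) (fun y z : Fin (K + 1) → S =>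
            t * ptGraphSwap μ (fun r : Fin m => (((0 : Fin (K + 1)), (κ r).succ) : Fin (K + 1) × Fin (K + 1))) φ y z
              + (1 - t) * prodKernel w M y z)
        ≤ min (t / (2 * K * v)) ((1 - t) * w 0 * ((∑ u ∈ A, μ 0 u) * ∑ u ∈ Aᶜ, μ 0 u) / (((K : ℝ) + 1) * v)) := by
  have he : ∀ r : Fin m, ((fun r : Fin m => (((0 : Fin (K + 1)), (κ r).succ) : Fin (K + 1) × Fin (K + 1))) r).1
      ≠ ((fun r : Fin m => (((0 : Fin (K + 1)), (κ r).succ) : Fin (K + 1) × Fin (K + 1))) r).2 :=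
    fun r => (Fin.succ_ne_zero (κ r)).symm
  refine ⟨dominatedStar_spectralGap_ge_regimeFree κ φ hK hm ht0 ht1 hw0 hw00 hw1 hμ hμ1 hM hMrev hM0 hp0 hp1 hdom hc1 hc,
    le_min ?_ ?_⟩
  · exact idleScheme_spectralGap_le_swap hK hm he hμ hμ1 hM hMrev hw0 hw1 ht0.le ht1.le hφA hvpos hv hidle
  · have h := idleScheme_spectralGap_le_hot he hμ hμ1 hM hMrev hw0 hw1 ht0.le ht1.le hφA hvpos hv hidle
    rw [exactSampler_edgeMeasure hM0 A] at h
    have e : (1 - t) * (w 0 * ((∑ u ∈ A, μ 0 u) * ∑ u ∈ Aᶜ, μ 0 u))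
        = (1 - t) * w 0 * ((∑ u ∈ A, μ 0 u) * ∑ u ∈ Aᶜ, μ 0 u) := by ring
    rw [e] at h
    exact h

/-- **UNIFORM LISTING (`m = cK`): `p·min{t/(3K), (1−t)w_0/(7K)} ≤ Gap ≤ min{t/(2Kv), (1−t)w_0/(4(K+1)v)}`** — both budgets
in the same unit `1/K`, from both sides (`μ_0(A)μ_0(Aᶜ) ≤ ¼`). [ours] -/
theorem uniformEntryStar_spectralGap_two_sided [Nontrivial S] (hK : 1 ≤ K) (ht0 : 0 < t) (ht1 : t < 1)
    (hw0 : ∀ k, 0 ≤ w k) (hw00 : 0 < w 0) (hw1 : ∑ k, w k = 1) (hμ : ∀ k x, 0 < μ k x)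
    (hμ1 : ∀ k, ∑ u, μ k u = 1) (hM : ∀ k, IsRowStochastic (M k)) (hMrev : ∀ k, DetailedBalance (μ k) (M k))
    (hM0 : ∀ u v, M 0 u v = μ 0 v) (hp0 : 0 < p) (hp1 : p ≤ 1) (hdom : ∀ r u, p * μ (κ r).succ (φ r u) ≤ μ 0 u)
    {c : ℕ} (hc1 : 1 ≤ c) (hc : ∀ p' : Fin K, c ≤ (univ.filter (fun r : Fin m => κ r = p')).card) (hmc : m = c * K)
    {A : Finset S} (hφA : ∀ r u, φ r u ∈ A ↔ u ∈ A) {v : ℝ} (hvpos : 0 < v)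
    (hv : ∀ k : Fin (K + 1), v ≤ (∑ u ∈ A, μ k u) * ∑ u ∈ Aᶜ, μ k u)
    (hidle : ∀ k : Fin (K + 1), k ≠ 0 → w k * edgeMeasure (μ k) (M k) A Aᶜ = 0) :
    p * min (t / (3 * K)) ((1 - t) * w 0 / (7 * K))
        ≤ spectralGap (tensorFun μ) (fun y z : Fin (K + 1) → S =>
            t * ptGraphSwap μ (fun r : Fin m => (((0 : Fin (K + 1)), (κ r).succ) : Fin (K + 1) × Fin (K + 1))) φ y z
              + (1 - t) * prodKernel w M y z)
      ∧ spectralGap (tensorFun μ) (fun y z : Fin (K + 1) → S =>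
            t * ptGraphSwap μ (fun r : Fin m => (((0 : Fin (K + 1)), (κ r).succ) : Fin (K + 1) × Fin (K + 1))) φ y z
              + (1 - t) * prodKernel w M y z)
        ≤ min (t / (2 * K * v)) ((1 - t) * w 0 / (4 * (((K : ℝ) + 1) * v))) := by
  have hm : 1 ≤ m := by rw [hmc]; exact Nat.one_le_iff_ne_zero.mpr (Nat.mul_ne_zero (by omega) (by omega))
  have hKpos : (0 : ℝ) < K := Nat.cast_pos.mpr (by omega)
  have hcpos : (0 : ℝ) < c := Nat.cast_pos.mpr (by omega)
  have hmR : (m : ℝ) = c * K := by rw [hmc, Nat.cast_mul]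
  have h1t : 0 < 1 - t := by linarith
  obtain ⟨hlo, hhi⟩ := entryStar_spectralGap_two_sided κ φ hK hm ht0 ht1 hw0 hw00 hw1 hμ hμ1 hM hMrev hM0 hp0 hp1 hdom hc1 hc
    hφA hvpos hv hidle
  refine ⟨?_, hhi.trans ?_⟩
  · have e : (c : ℝ) * t / (3 * m) = t / (3 * K) := by
      rw [hmR]; field_simp
    rw [← e]; exact hlo
  · -- `μ_0(A)μ_0(Aᶜ) ≤ ¼`
    refine min_le_min le_rfl ?_
    have hsum : ∑ u ∈ A, μ 0 u + ∑ u ∈ Aᶜ, μ 0 u = 1 := by rw [Finset.sum_add_sum_compl, hμ1 0]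
    have hq : (∑ u ∈ A, μ 0 u) * ∑ u ∈ Aᶜ, μ 0 u ≤ 1 / 4 := by
      nlinarith [sq_nonneg (∑ u ∈ A, μ 0 u - ∑ u ∈ Aᶜ, μ 0 u)]
    have hKv : 0 < ((K : ℝ) + 1) * v := by positivity
    rw [div_le_div_iff₀ hKv (by positivity)]
    have hw' : 0 ≤ (1 - t) * w 0 := by positivity
    nlinarith [mul_le_mul_of_nonneg_left hq hw', hKv]

/-- **THE COST OF ONE RELAXATION TIME AT HALF SWAPS, FROM BOTH SIDES** (`t = 1/2`, `w_0 = 1`, `m = cK`; a swap test costs `κ_s`,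
the exact hot draw `κ_u`, cold updates have weight `0`; sector-preserving entry maps, sector-idle reversible cold kernels,
`μ_k(A)μ_k(Aᶜ) ≥ v > 0`; `Gap > 0` is part of the conclusion):
`2Kv·κ_s + (K+1)v·κ_u/(μ_0(A)μ_0(Aᶜ)) ≤ ((κ_s + κ_u)/2)/Gap` (K7) and `((κ_s + κ_u)/2)·t_rel ≤ 7K(κ_s + κ_u)/p` (N5). [ours] -/
theorem halfStar_relaxationCost_two_sided [Nontrivial S] (hK : 1 ≤ K) (hw0 : ∀ k, 0 ≤ w k) (hw01 : w 0 = 1)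
    (hw1 : ∑ k, w k = 1) (hμ : ∀ k x, 0 < μ k x) (hμ1 : ∀ k, ∑ u, μ k u = 1) (hM : ∀ k, IsRowStochastic (M k))
    (hMrev : ∀ k, DetailedBalance (μ k) (M k)) (hM0 : ∀ u v, M 0 u v = μ 0 v) (hp0 : 0 < p) (hp1 : p ≤ 1)
    (hdom : ∀ r u, p * μ (κ r).succ (φ r u) ≤ μ 0 u)
    {c : ℕ} (hc1 : 1 ≤ c) (hc : ∀ p' : Fin K, c ≤ (univ.filter (fun r : Fin m => κ r = p')).card) (hmc : m = c * K)
    {A : Finset S} (hφA : ∀ r u, φ r u ∈ A ↔ u ∈ A) {v : ℝ} (hvpos : 0 < v)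
    (hv : ∀ k : Fin (K + 1), v ≤ (∑ u ∈ A, μ k u) * ∑ u ∈ Aᶜ, μ k u)
    (hidle : ∀ k : Fin (K + 1), k ≠ 0 → w k * edgeMeasure (μ k) (M k) A Aᶜ = 0)
    {κs κu : ℝ} (hκs : 0 ≤ κs) (hκu : 0 ≤ κu) :
    2 * K * v * κs + ((K : ℝ) + 1) * v * κu / ((∑ u ∈ A, μ 0 u) * ∑ u ∈ Aᶜ, μ 0 u)
        ≤ ((1 / 2 : ℝ) * κs + (1 - 1 / 2) * ∑ k, w k * (if k = 0 then κu else 0))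
            / spectralGap (tensorFun μ) (fun y z : Fin (K + 1) → S =>
                (1 / 2 : ℝ) * ptGraphSwap μ (fun r : Fin m => (((0 : Fin (K + 1)), (κ r).succ) : Fin (K + 1) × Fin (K + 1))) φ y z
                  + (1 - 1 / 2) * prodKernel w M y z)
      ∧ ((κs + κu) / 2) * relaxationTime (fun y z : Fin (K + 1) → S =>
            (1 / 2 : ℝ) * ptGraphSwap μ (fun r : Fin m => (((0 : Fin (K + 1)), (κ r).succ) : Fin (K + 1) × Fin (K + 1))) φ y z
              + (1 - 1 / 2) * prodKernel w M y z)
          ≤ 7 * K * (κs + κu) / p := by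
  have hm : 1 ≤ m := by rw [hmc]; exact Nat.one_le_iff_ne_zero.mpr (Nat.mul_ne_zero (by omega) (by omega))
  have hKpos : (0 : ℝ) < K := Nat.cast_pos.mpr (by omega)
  have hcpos : (0 : ℝ) < c := Nat.cast_pos.mpr (by omega)
  have hmR : (m : ℝ) = c * K := by rw [hmc, Nat.cast_mul]
  have hmcK : (m : ℝ) ≤ c * K := hmR.le
  have he : ∀ r : Fin m, ((fun r : Fin m => (((0 : Fin (K + 1)), (κ r).succ) : Fin (K + 1) × Fin (K + 1))) r).1
      ≠ ((fun r : Fin m => (((0 : Fin (K + 1)), (κ r).succ) : Fin (K + 1) × Fin (K + 1))) r).2 :=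
    fun r => (Fin.succ_ne_zero (κ r)).symm
  have hw00 : 0 < w 0 := by rw [hw01]; exact one_pos
  refine ⟨?_, halfStar_relaxationCost_le κ φ hK hm hw0 hw01 hw1 hμ hμ1 hM hMrev hM0 hp0 hp1 hdom hc1 hc hmcK hκs hκu⟩
  -- K7's universal floor with cost vector `κ = (κ_u, 0, …, 0)`
  have hQ0 : 0 < edgeMeasure (μ 0) (M 0) A Aᶜ := by
    rw [exactSampler_edgeMeasure hM0 A]; exact lt_of_lt_of_le hvpos (hv 0)
  have hgap : 0 < spectralGap (tensorFun μ) (fun y z : Fin (K + 1) → S =>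
      (1 / 2 : ℝ) * ptGraphSwap μ (fun r : Fin m => (((0 : Fin (K + 1)), (κ r).succ) : Fin (K + 1) × Fin (K + 1))) φ y z
        + (1 - 1 / 2) * prodKernel w M y z) := by
    have h := dominatedStar_spectralGap_ge_regimeFree κ φ hK hm (t := 1 / 2) (by norm_num) (by norm_num) hw0 hw00 hw1 hμ
      hμ1 hM hMrev hM0 hp0 hp1 hdom hc1 hc
    have hmpos : (0 : ℝ) < m := Nat.cast_pos.mpr (by omega)
    have hpos : 0 < p * min (c * (1 / 2) / (3 * (m : ℝ))) ((1 - 1 / 2) * w 0 / (7 * K)) :=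
      mul_pos hp0 (lt_min (by positivity) (by rw [hw01]; positivity))
    exact lt_of_lt_of_le hpos h
  have h := idleScheme_relaxationCost_ge hK hm he hμ hμ1 hM hMrev hw0 hw1 (by norm_num : (0 : ℝ) ≤ 1 / 2)
    (by norm_num : (1 / 2 : ℝ) ≤ 1) hφA hvpos hv hidle hQ0 hκs (κ := fun k => if k = 0 then κu else 0)
    (fun k => by positivity) hgap
  rw [if_pos rfl, exactSampler_edgeMeasure hM0 A] at h
  exact h

end Law

end Summit.Ventures.LatticeQCDFlow.Scaling

end
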